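import Mathlib
import HarnessLib
import HarnessLib.Audit
import Summits.ABC.ABC.Statement
import Literature.NumberTheory.EllipticCurves.MordellWeil
import Literature.NumberTheory.EllipticCurves.HeightFamily

/-!
Route: FermatTwistHeights

CLOSED (retired) 2026-08-15T13:35:59Z by operator:999:1090267 — reason: not-a-thesis: assembly does not conclude the sub-problem Statement — note: D-0027 §2.1 audit (human 2026-08-15: routes that do not decide the summit are removed): the assembly concludes `PolynomialABC`, not the sub-problem statement; a NEW conforming route may be opened from the same idea (generated `closes : … → _root_.ABC`).. The file is kept as the record of this route; refuted decls are indexed as negative knowledge (`ledger negatives`).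

Thesis (realises idea card ABC/ABC/fermat-shadow-pattern-slicing, 'Fermat shadows'). Extracting p-th
powers writes every abc triple as a + b = c = (A x^p) + (B y^p) = (C z^p): a primitive Q-rational
point (x:y:z), with pairwise-coprime terms, of the diagonal twist A X^p + B Y^p = C Z^p of the
Fermat curve F_p, indexed by the triple's own exponent pattern (A,B,C) (examples: Reyssat 2 +
3^10·109 = 23^5 is (1:9:23) on 2U^4 + 981V^4 = 23W^4; 1 + 80 = 81 is (1:2:3) on U^4 + 5V^4 = W^4). X
:= TwistHeightBound: for SOME p >= 4 and every delta > 0 there is H0(p,delta) such that every such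
point with rad(ABC) <= H^(p-3-delta), H = max(x,y,z), has H <= H0 — 'no large rational points on
twisted Fermat curves, measured against the radical of the COEFFICIENTS only', uniformly over the
twist family. It suffices to show X for POLYNOMIAL abc: X ==> c <= K·rad(abc)^(p-1+p/(p-3-delta))
for all abc triples (Lemma B = the Assembly: either H is small against rad(ABC) <= rad(abc), or the
point is one of the bounded exceptions; C <= rad(c)^(p-1)), i.e. the shared milestone PolynomialABC
(stmt-ABC-1724; = Literature.Barriers.ABC.BakerShapeBound 0 1 up to logs); the rung p = 5
(QuinticTwistHeightBound) gives exponent 13/2 + eta, the rung p = 4 (QuarticTwistHeightBound;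
CM-split Jacobian, quadratic-Chabauty regime = crux LowRankQuarticHeightGap) gives 7 + eta.
Conversely ABC ==> X for every p (Lemma A, support item AbcImpliesTwistHeightBounds), so X is a
NECESSARY waypoint strictly between ABC and polynomial abc, and a refutation target in new
coordinates. HONEST CEILING: this route does not reach Summit ABC (the loss rad(c)^(p-1) of Lemma B
is intrinsic); its conclusion is the polynomial Baker shape (0,1), which no unconditional method
reaches (Stewart–Yu (1/3,3)). Lean: X := ∃ p ≥ 4, ∀ δ > 0, ∃ H₀, ∀ A B C x y z : ℕ, IsABCTriple
(A*x^p) (B*y^p) (C*z^p) → (rad A B C : ℝ) ≤ (max x (max y z) : ℝ) ^ ((p:ℝ) - 3 - δ) → (max x (max y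
z) : ℝ) ≤ H₀ (IsABCTriple, rad from Literature.NumberTheory.DiophantineGeometry); Assembly := X →
PolynomialABC, PolynomialABC := ∃ A C : ℝ, ∀ a b c, IsABCTriple a b c → (c : ℝ) ≤ C * (rad a b c :
ℝ) ^ A.

Rationale: WHY THIS LINE. abc weighs size against the radical of the unknowns; the card trades this for a
radical-free Diophantine statement of the best-understood kind — archimedean heights of Q-RATIONAL
points on smooth projective curves over Q of fixed genus (3 at p = 4, 6 at p = 5), uniform over a
Q-twist family and measured against the radical of the COEFFICIENTS. Structurally it is the genus >=
3 / rational-point counterpart of strong Hall (integral points on the genus-1 twist family y^2 = x^3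
+ k, uniform in k), which is EQUIVALENT to abc [BombieriGubler2006, Thm 12.5.12, Conj. 12.5.14, Rem.
12.5.16, pp. 433–435 read], and the fixed-exponent / Q-twist counterpart of Vojta's derivation of
abc from his height inequality for ALGEBRAIC points on X_n [Vojta1987, Ex. 5.5.2, pp. 71–72 read;
Elkies1991ABCMordell]: no number fields and no discriminant term occur, at the price of polynomial
loss (sandwich ABC ==> X ==> abc with exponent p-1+p/(p-3), minimised to 13/2 at p = 5). Area
imported: arithmetic of curves over Q — Faltings finiteness per twist [BombieriGubler2006 §12.6;
DarmonGranville1995 for A = B = C = 1], uniform Mordell–Lang counts #X_(A,B,C)(Q) <= c^(1+rank J(Q))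
[DimitrovGaoHabegger2021], and at p = 4 the CM-split Jacobian J(X_(A,B,C)) ~ E_(ABC^2) x E_(-A^2BC)
x E_(-AB^2C), E_D : y^2 = x^3 + Dx (bielliptic quotients by the three sign involutions; Kani–Rosen),
which places the rank-3/4 patterns inside the quadratic-Chabauty regime r <= g + rho - 2 = 4
[BalakrishnanDogra2018, BalakrishnanEtAl2019; PoonenSchaeferStoll2007 for explicit work on genus-3
twists of the Klein quartic] — the one regime where finiteness is explicit enough that an
archimedean statement might be extracted. Catalogue entry used: geometric lift (triple -> point on a
twist indexed by its exponent pattern); no physical analogy, no transfer principle, certified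
computation only as the refuters' calibration job.
RANKED CRUXES. (2) LowRankQuarticHeightGap — on the quadratic-Chabauty locus (rank sum of the three
CM shadows <= 4) an a-priori bound H <= H0·rad(ABC)^kappa uniform in the pattern: the only slot
where a MECHANISM can appear (p-adic heights are global quadratic forms there; missing: an
archimedean comparison for the finitely many QC solutions). (3) QuarticTwistHeightBound =
F_4(delta), all patterns (exponent 7 + eta). (4) QuinticTwistHeightBound = F_5(delta) (genus 6;
exponent 13/2 + eta). Target TwistHeightBound = 'some rung' (each rung closes it by a one-line glue,
typechecked in the planner sketch); Assembly = Lemma B (provable now); support: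
AbcImpliesTwistHeightBounds (Lemma A, provable now), QuinticExponentThirteenHalves (the 13/2
bookkeeping, provable now).
KILL CRITERIA. (i) A refuter reduces LowRankQuarticHeightGap to known results, or shows that QC/DGH
output is provably height-blind uniformly in the twist with no archimedean handle — the route keeps
coordinates but no engine: dormant. (ii) Calibration (kit: lattice / p-adic search for (x:y:z) on A
x^4 + B y^4 = C z^4 with H > rad(ABC)^1.2, |ABC| <= 10^12; de Smit's table re-indexed by 4- and
5-pattern): a sup of log H / log rad(ABC) drifting above 1 (p = 4) or 1/2 (p = 5) along growing rad
is evidence against small delta — each hit is also a high-quality abc triple, and an infinite family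
refutes Summit ABC itself via AbcImpliesTwistHeightBounds. (iii) PolynomialABC (shared item
stmt-ABC-1724) lands by another line — close superseded (the sibling card afc-log-uniform-fermat
reaches only BakerShapeBound 0 2, so no conflict; if it is routed the milestones are shared, no crux
is).
NOT DECOMPOSED YET (deliberately). Finiteness-by-pattern (Faltings for each twist; not statable in
tree); the shadow-point identities (u:v:w) -> (ACu^2/v^2, AC^2uw^2/v^3) in E_(ABC^2)(Q) (decoration
until crux 2 moves); the Vojta-dictionary form of F_p (no Vojta decl); any split of F_4 by rank
regime beyond crux 2; the glues F_4 -> Target, F_5 -> Target. Proofs about ranks may take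
Mordell–Weil (WeierstrassCurve.module_finite_point) as a named-fact hypothesis; no item's STATEMENT
uses an unproved named fact. Negatives index empty at filing (ledger negatives --problem ABC).

Novelty: Prior art actually searched (2026-08-15): zbMATH 'diagonal quartic rational points' (only diagonal
cubic SURFACE hits), 'twists of X(7)' (PoonenSchaeferStoll2007), 'Uniformity in Mordell-Lang'
(DimitrovGaoHabegger2021, arXiv:2001.10276), 'quadratic Chabauty' (BalakrishnanDogra2018,
BalakrishnanEtAl2019), 'abc Fermat quartic twists' / 'generalized Fermat abc height bound' (nil);
READ: BombieriGubler2006 pp. 433–435 (Thm 12.5.12 abc <=> strong Hall <=> gen. Szpiro; Conj.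
12.5.14; Rem. 12.5.16), Vojta1987 §5.5 pp. 71–72 (Ex. 5.5.2: Vojta-with-d(P) for ALGEBRAIC points on
X_n ==> abc) + App. ABC 5.A.1; from the card and two refuter audits: Granville2007Twists
doi:10.1093/imrn/rnm027 (abc ==> few quadratic twists have points; one direction only),
DarmonGranville1995, Elkies1991ABCMordell; OpenAlex/arXiv rate-limited today; galaxy 'twists of the
Fermat quartic' 0 hits. DELTA: (i) F_p(delta) — Q-RATIONAL points on the Q-twist FAMILY of one
Fermat curve, uniform against rad(coefficients) — with the sandwich ABC ==> F_p ==> abc with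
exponent p-1+p/(p-3), optimal 13/2 at p = 5; no converse of this kind found in print (strong Hall /
B–G 12.5.12 is the genus-1 INTEGRAL analogue, Vojta Ex. 5.5.2 the number-field analogue); (ii) the
CM-split Jacobian of the quartic twists placing rank-3/4 patterns in the quadratic-Chabauty regime,
with DGH counts per slice. Graded new-combination by triage; no new-mechanism claim (no archimedean
engine yet = crux 2).  [refs: 10.1093/imrn/rnm027, 2001.10276, doi:10.1093/imrn/rnm027, PoonenSchaeferStoll2007, DimitrovGaoHabegger2021, BalakrishnanDogra2018, BalakrishnanEtAl2019, BombieriGubler2006, Vojta1987, DarmonGranville1995]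

Barriers (technique_class: fermat-twist-heights effective-mordell quadratic-chabauty): - technique_class: fermat-twist-heights effective-mordell quadratic-chabauty
- Literature.Barriers.ABC.BakerMethodBounds: the OUTPUT is BakerShapeBound 0 1 (polynomial in rad),
beyond what linear forms in logarithms deliver ((1/3,3)); nothing transcendental is imported — the
engine sought is Mordell-uniformity / p-adic period maps. Evasion by class; the bet is crux 2.
- Literature.Barriers.ABC.EpsilonCannotBeDropped: not engaged — every statement keeps delta > 0 or
an unspecified exponent; F_p(0) is not claimed; known witness families sit in the trivial layer,
consistent with F_p(delta).
- Literature.Barriers.ABC.ExplicitABCQualityFloor: consistent — Reyssat = (1:9:23) on 2U^4 + 981V^4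
= 23W^4, log H / log rad(ABC) ≈ 0.33 < 1.
- Literature.Barriers.ABC.HallExponentSharp: the genus-1 integral analogue has Danilov families AT
the exponent boundary; boundary families here (H ≍ rad(ABC)^(1/(p-3)) infinitely often) are
permitted by delta > 0 — calibration question, no conflict.
- Literature.Barriers.ABC.TijdemanZagierNeedsExponentThree: respected — signatures (p,p,p), p >= 4,
with coefficients; no emptiness claimed (every abc triple IS a point), only height bounds.
- Literature.Barriers.ABC.UniformABCDiscriminantSharp,
Literature.Barriers.ABC.UniformABCImpliesNoSiegelZeros: not triggered — all over Q (rational points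
of Q-twists), no field-discriminant uniformity.
- NConjecture/IUT/charP/derivation barriers: not engaged; negatives index empty.

Novelty grade: new-combination — Route-review grading (refuter), based on MY reading of B–G pp. 433–435 this session plus the planner's documented searches. Nearest prior art: the Target/rungs F_p(δ) are the Hall–Lang–Waldschmidt–Szpiro conjecture (B–G Conj. 12.5.14: Ax^m + By^n = z ⇒ |x|^{mn−m−n} ≪ rad(z)^{n+ε}) at (m,n) = (p,p),  (refuter refuter-rreview-route-ABC-FermatTwistHei-77df07f5-0, 2026-08-15T12:36:35Z; prior: doi:10.1017/cbo9780511542879 (Bombieri–Gubler 2006, Conj. 12.5.14 Hall–Lang–Waldschmidt–Szpiro, Thm 12.5.12, 12.5.15, pp. 433–435 read), Vojta1987 (Ex. 5.5.2, App. ABC), DimitrovGaoHabegger2021 arXiv:2001.10276, BalakrishnanDogra2018, Granville2007Twists doi:10.1093/imrn/rnm027)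

History (route lifecycle, newest last):
- 2026-08-15T13:36:01Z · CLOSED retired — not-a-thesis: assembly does not conclude the sub-problem Statement (operator:999:1090267)

sub-problem: ABC · status: closed(retired) · opened planner-plancard-ABC-ABC-fermat-shadow-patter-97a0668b-0 2026-08-15T11:02:42Z · rev 1 · ledger route-ABC-FermatTwistHeights
GENERATED by the gate from the ledger (D-0016/17). Provers cite these decls: `theorem foo : Summit.ABC.ABC.Theses.FermatTwistHeights.<Decl> := …` in Summits/ABC/ABC/Theorems/<Name>.lean.
-/

namespace Summit.ABC.ABC.Theses.FermatTwistHeights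

open scoped BigOperators Topology Manifold Classical MeasureTheory ProbabilityTheory Matrix InnerProductSpace ComplexConjugate ContinuousMap
open Filter Set Function TopologicalSpace MeasureTheory

attribute [summit_statement] _root_.ABC

open Literature.Abc

/-- item stmt-ABC-2263 · target · rank 0 · closed · moot by None · by planner
why it might fail: No method bounds archimedean heights of rational points uniformly in a twist family (Faltings/Lawrence-Venkatesh ineffective, Chabauty-Kim per-curve and p-adic, Baker-type bounds exponential); X => polynomial abc = BakerShapeBound 0 1, which no unconditional engine reaches.
sources: Vojta1987, BombieriGubler2006, Elkies1991ABCMordell, DarmonGranville1995, StewartYu2001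
[target] X = 'some Fermat-twist family has radical-relative height uniformity': ∃ p ≥ 4 ∀ δ > 0 ∃
H₀(p,δ) such that every primitive point (x:y:z) of a diagonal twist A X^p + B Y^p = C Z^p with
pairwise-coprime terms (IsABCTriple (A x^p) (B y^p) (C z^p)) and rad(ABC) ≤ H^(p−3−δ), H =
max(x,y,z), has H ≤ H₀. Every abc triple is such a point of the twist indexed by its own exponent
pattern (p-th-power extraction), so X ⟹ c ≤ K·rad(abc)^(p−1+p/(p−3−δ)) (Assembly) and ABC ⟹ X
(AbcImpliesTwistHeightBounds). Closed by either rung: QuarticTwistHeightBound (p = 4; glue ⟨4, _⟩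
using (4:ℝ)−3−δ = 1−δ) or QuinticTwistHeightBound (p = 5); both one-line glues were typechecked in
the planner sketch and are not filed. Sources: card ABC/ABC/fermat-shadow-pattern-slicing; Vojta1987
Ex. 5.5.2; BombieriGubler2006 Thm 12.5.12; Elkies1991ABCMordell. -/
@[route_item "route-ABC-FermatTwistHeights"]
def TwistHeightBound : Prop :=
  ∃ p : ℕ, 4 ≤ p ∧ ∀ δ : ℝ, 0 < δ → ∃ H₀ : ℝ, ∀ A B C x y z : ℕ, Literature.NumberTheory.DiophantineGeometry.IsABCTriple (A * x ^ p) (B * y ^ p) (C * z ^ p) → ((Literature.NumberTheory.DiophantineGeometry.rad A B C : ℕ) : ℝ) ≤ ((max x (max y z) : ℕ) : ℝ) ^ ((p : ℝ) - 3 - δ) → ((max x (max y z) : ℕ) : ℝ) ≤ H₀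

/-- item stmt-ABC-2265 · crux · rank 2 · closed · moot by None · by planner
why it might fail: abc-strength even on the rank-sum<=4 slice (there it yields c << rad(abc)^(3+4kappa), polynomial abc); quadratic Chabauty / Chabauty-Kim output is p-adic, per-curve and needs Mordell-Weil generators, DGH only counts points: no archimedean, twist-uniform handle is known; the slice may also be thin.
sources: BalakrishnanDogra2018, BalakrishnanEtAl2019, DimitrovGaoHabegger2021, PoonenSchaeferStoll2007, Elkies1991ABCMordell
[crux] The engine slot (p = 4, quadratic-Chabauty regime). X_(A,B,C): A u⁴ + B v⁴ = C w⁴ is a smooth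
plane quartic (genus 3); its quotients by the three sign involutions are genus-1 curves (C t² = A u⁴
+ B v⁴ etc.) with Jacobians E_(ABC²), E_(−A²BC), E_(−AB²C) up to 2-isogeny (E_D : y² = x³ + Dx;
Jac(T² = aU⁴ + e) is Y² = X³ − 4aeX, E_D ~ E_(−4D)), and J(X_(A,B,C)) ~ E_(ABC²) × E_(−A²BC) ×
E_(−AB²C) (Kani–Rosen). Every point gives P₁ = (ACu²/v², AC²uw²/v³) ∈ E_(ABC²)(ℚ), non-torsion
unless ABC² ∈ 4ℚ⁴, so inhabited patterns have rank sum r ≥ 3: classical Chabauty (r ≤ 2) never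
applies; quadratic Chabauty applies iff r ≤ g + ρ − 2 = 4 (ρ(J) = 3). STATEMENT: on that locus (sum
of mordellWeilRank of the three shortWeierstrass (D,0) models ≤ 4) an a-priori POLYNOMIAL bound H ≤
H₀·rad(ABC)^κ, uniform in the pattern. Implied by ABC with κ = 1+δ' (Lemma A), so not cheaply
refutable; a proof would be the first archimedean output of a p-adic period method — where this
route expects its mechanism (QC p-adic heights are global quadratic forms; missing: an archimedean
comparison for the finitely many QC solutions, uniform in D). Mordell–Weil / Faltings may enter as
named-fact hypotheses. -/
@[route_item "route-ABC-FermatTwistHeights"]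
def LowRankQuarticHeightGap : Prop :=
  ∃ κ H₀ : ℝ, ∀ A B C x y z : ℕ, Literature.NumberTheory.DiophantineGeometry.IsABCTriple (A * x ^ 4) (B * y ^ 4) (C * z ^ 4) → (Literature.NumberTheory.EllipticCurves.shortWeierstrass (((A * B * C ^ 2 : ℕ) : ℤ), 0)).mordellWeilRank + (Literature.NumberTheory.EllipticCurves.shortWeierstrass (-((A ^ 2 * B * C : ℕ) : ℤ), 0)).mordellWeilRank + (Literature.NumberTheory.EllipticCurves.shortWeierstrass (-((A * B ^ 2 * C : ℕ) : ℤ), 0)).mordellWeilRank ≤ 4 → ((max x (max y z) : ℕ) : ℝ) ≤ H₀ * ((Literature.NumberTheory.DiophantineGeometry.rad A B C : ℕ) : ℝ) ^ κ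

/-- item stmt-ABC-2266 · crux · rank 3 · closed · moot by None · by planner
why it might fail: abc-strength on the quartic-pattern locus (ABC => F_4 => c << rad(abc)^(7+eta), past every unconditional bound: Stewart-Yu is exponential); no method bounds real heights of rational points uniformly over a twist family: Faltings/Lawrence-Venkatesh ineffective, Chabauty per-curve, Baker exponential.
sources: Vojta1987, BombieriGubler2006, Granville2007Twists, DarmonGranville1995, Elkies1991ABCMordell, StewartYu2001
[crux] F_4(δ): for every δ > 0 there is H₀(δ) such that every primitive point of A X⁴ + B Y⁴ = C Z⁴
with pairwise-coprime terms and rad(ABC) ≤ H^(1−δ) has H ≤ H₀ — 'rational points on twisted Fermat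
quartics have height ≤ rad(coefficients)^(1+δ') up to finitely many exceptions', uniformly in the
twist (no p-th-power-free or |xyz| ≥ 2 clause needed: H = 1 makes the radical hypothesis impossible;
p-th powers inside A, B, C only weaken it). Examples (verified): Reyssat 2 + 3¹⁰·109 = 23⁵ is
(1:9:23) on 2U⁴ + 981V⁴ = 23W⁴ (log H/log rad(ABC) ≈ 0.33); 1 + 80 = 81 is (1:2:3) on U⁴ + 5V⁴ = W⁴.
ABC ⟹ F_4 (Lemma A); F_4 ⟹ Target ⟹ c ≪ rad^(7+η). Genus-3 RATIONAL-point counterpart of strong Hall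
(integral points on y² = x³ + k uniform in k ⟺ abc, BombieriGubler2006 Thm 12.5.12) and ℚ-twist /
fixed-exponent counterpart of Vojta1987 Ex. 5.5.2 (algebraic points on X_n ⟹ abc);
Granville2007Twists has only abc ⟹ (few twists have points). Refuter calibration (kit): lattice /
p-adic search for points with H > rad(ABC)^1.2, |ABC| ≤ 10¹², H ≤ 10⁹ — each hit is a high-quality
abc triple; sup log H/log rad(ABC) drifting above 1 along growing rad is evidence against small δ. -/
@[route_item "route-ABC-FermatTwistHeights"]
def QuarticTwistHeightBound : Prop :=
  ∀ δ : ℝ, 0 < δ → ∃ H₀ : ℝ, ∀ A B C x y z : ℕ, Literature.NumberTheory.DiophantineGeometry.IsABCTriple (A * x ^ 4) (B * y ^ 4) (C * z ^ 4) → ((Literature.NumberTheory.DiophantineGeometry.rad A B C : ℕ) : ℝ) ≤ ((max x (max y z) : ℕ) : ℝ) ^ (1 - δ) → ((max x (max y z) : ℕ) : ℝ) ≤ H₀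

/-- item stmt-ABC-2267 · crux · rank 4 · closed · moot by None · by planner
why it might fail: abc-strength on the quintic-pattern locus (F_5 => c << rad(abc)^(13/2+eta), far past Stewart-Yu); genus 6 with non-split Jacobian: no bielliptic quotients, no quadratic-Chabauty regime, only ineffective per-twist Faltings finiteness and DGH point counts — nothing bounds heights.
sources: Vojta1987, BombieriGubler2006, DimitrovGaoHabegger2021, DarmonGranville1995, StewartYu2001
[crux] F_5(δ): the same for A X⁵ + B Y⁵ = C Z⁵ (twists of the Fermat quintic: smooth plane quintics,
genus 6, J(F₅) with CM by ℚ(ζ₅), not split over ℚ) with threshold rad(ABC) ≤ H^(2−δ): 'no large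
rational points on twisted quintics relative to √rad(coefficients)'. This is the rung that optimises
Lemma B — the exponent p−1+p/(p−3) is 7 at p = 4 and 6, 7.75 at p = 7 and 13/2 at p = 5
(QuinticExponentThirteenHalves: F_5 ⟹ c ≤ K rad(abc)^(13/2+η)). ABC ⟹ F_5 (Lemma A with H⁵ ≤ c).
Known: per-twist finiteness (Faltings; BombieriGubler2006 §12.6, the p = q = r ≥ 4 case), uniform
COUNTS per twist (DimitrovGaoHabegger2021, #X(ℚ) ≤ c^(1+rank)); nothing bounds heights. F_5 ⟹ Target
by the one-line glue ⟨5, _⟩ ((5:ℝ)−3−δ = 2−δ), typechecked in the planner sketch. -/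
@[route_item "route-ABC-FermatTwistHeights"]
def QuinticTwistHeightBound : Prop :=
  ∀ δ : ℝ, 0 < δ → ∃ H₀ : ℝ, ∀ A B C x y z : ℕ, Literature.NumberTheory.DiophantineGeometry.IsABCTriple (A * x ^ 5) (B * y ^ 5) (C * z ^ 5) → ((Literature.NumberTheory.DiophantineGeometry.rad A B C : ℕ) : ℝ) ≤ ((max x (max y z) : ℕ) : ℝ) ^ (2 - δ) → ((max x (max y z) : ℕ) : ℝ) ≤ H₀

/-- item stmt-ABC-1724 · support · rank 9 · open · by planner
sources: StewartYu2001, Pasten2024, Literature.Barriers.ABC.BakerMethodBounds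
[crux, rank 3 — milestone] Polynomial abc: c ≤ C·rad(abc)^A for SOME absolute A, C. Equivalent (up
to taking logs) to Literature.Barriers.ABC.BakerShapeBound 0 1, i.e. the shape the BakerMethodBounds
barrier says logarithmic forms cannot deliver (state of the art: BakerShapeBound (1/3) 3 =
stewart_yu). It is the FIRST typed promise of any log-weighted receptacle: ReceptacleIdentity with
crude constants c₁, c₂, c₃ gives log|Δ_min| ≤ (c₂/c₁)·log N + O(1) for all semistable Frey curves,
hence (abc)² ≤ C·2⁸·rad(abc)^{c₂/c₁}, hence this with A = c₂/(2c₁). Not in the Assembly chain by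
design (implied by ABC; a progress/kill marker for the mechanism, shared with every route that must
first cross the Baker barrier). Why it might fail: open since Oesterlé–Masser; every known
unconditional engine is exponential in a power of rad (StewartTijdeman1986, StewartYu1991,
StewartYu2001, Pasten2024 subexponential only in special regimes). Sources: StewartYu2001,
Pasten2024, Literature.Barriers.ABC.BakerMethodBounds. -/
@[route_item "route-ABC-FermatTwistHeights"]
def PolynomialABC : Prop :=
  ∃ A C : ℝ, ∀ a b c : ℕ, Literature.NumberTheory.DiophantineGeometry.IsABCTriple a b c → (c : ℝ) ≤ C * ((Literature.NumberTheory.DiophantineGeometry.rad a b c : ℕ) : ℝ) ^ A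

/-- item stmt-ABC-2268 · support · rank 9 · closed · moot by None · by planner
sources: Vojta1987, BombieriGubler2006
[support] Lemma A (provable now; certifies that the Target and both rungs are NECESSARY consequences
of Summit ABC, so a refutation of any F_p instance refutes ABC — the negative-side use of this
route). Given ABC, p ≥ 4 and δ > 0 put ε := δ/(2(p−δ)) and take C(ε) from ABC. For a point as in the
Target, (A x^p, B y^p, C z^p) is an abc triple with c = C z^p ≥ H^p (x^p ≤ A x^p < c, y^p ≤ B y^p <
c, z^p ≤ C z^p = c; x, y, z ≥ 1 by positivity) and rad(abc) = rad(ABC·(xyz)^p) ≤ rad(ABC)·rad(xyz) ≤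
rad(ABC)·H³ ≤ H^(p−δ) under the hypothesis rad(ABC) ≤ H^(p−3−δ). So H^p ≤ c < C(ε)·H^((p−δ)(1+ε)) =
C(ε)·H^(p−δ/2), i.e. H^(δ/2) < C(ε) and H < C(ε)^(2/δ) =: H₀ (H ≥ 1). In tree: IsABCTriple, rad =
UniqueFactorizationMonoid.radical (a*b*c) in ℕ (rad_def), Mathlib's radical lemmas /
Nat.primeFactors, Real.rpow algebra. The same computation is Vojta1987 5.A.1 (abc ⟹
Hall–Lang–Waldschmidt–Szpiro) and BombieriGubler2006 12.5.15. -/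
@[route_item "route-ABC-FermatTwistHeights"]
def AbcImpliesTwistHeightBounds : Prop :=
  _root_.ABC → ∀ p : ℕ, 4 ≤ p → ∀ δ : ℝ, 0 < δ → ∃ H₀ : ℝ, ∀ A B C x y z : ℕ, Literature.NumberTheory.DiophantineGeometry.IsABCTriple (A * x ^ p) (B * y ^ p) (C * z ^ p) → ((Literature.NumberTheory.DiophantineGeometry.rad A B C : ℕ) : ℝ) ≤ ((max x (max y z) : ℕ) : ℝ) ^ ((p : ℝ) - 3 - δ) → ((max x (max y z) : ℕ) : ℝ) ≤ H₀

/-- item stmt-ABC-2269 · support · rank 9 · closed · moot by None · by planner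
sources: BombieriGubler2006
[support] Lemma B made sharp at p = 5 (provable now): QuinticTwistHeightBound → ∀ η > 0 ∃ K ∀ abc
triples, c ≤ K·rad(abc)^(13/2 + η). Proof: extract fifth powers canonically (a = A x⁵ with x = ∏
q^⌊v_q(a)/5⌋ via Nat.factorization, etc.); (A x⁵, B y⁵, C z⁵) = (a, b, c) literally, so IsABCTriple
(A x⁵) (B y⁵) (C z⁵) holds; C ≤ rad(c)⁴ ≤ r⁴ and rad(ABC) ≤ r := rad(abc). Choose δ ∈ (0, 2) with
5/(2−δ) ≤ 5/2 + η (e.g. δ = min(1, 4η/(5+2η))) and H₀ = H₀(δ) ≥ 1. If rad(ABC) ≤ H^(2−δ) then H ≤ H₀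
and c = C z⁵ ≤ r⁴ H₀⁵ ≤ H₀⁵ r^(13/2+η); else H < r^(1/(2−δ)) and c ≤ r⁴ H⁵ ≤ r^(4 + 5/(2−δ)) ≤
r^(13/2+η) (r ≥ 1). Take K = max(1, H₀)⁵. The analogous p = 4 bookkeeping gives 7 + η and is not
filed separately. Shared-milestone note: the sibling card afc-log-uniform-fermat ends at
BakerShapeBound 0 2 (quasi-polynomial); this item is the polynomial record of the Fermat-shadow
line. -/
@[route_item "route-ABC-FermatTwistHeights"]
def QuinticExponentThirteenHalves : Prop :=
  QuinticTwistHeightBound → ∀ η : ℝ, 0 < η → ∃ K : ℝ, ∀ a b c : ℕ, Literature.NumberTheory.DiophantineGeometry.IsABCTriple a b c → (c : ℝ) ≤ K * ((Literature.NumberTheory.DiophantineGeometry.rad a b c : ℕ) : ℝ) ^ ((13 : ℝ) / 2 + η)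

/-- item stmt-ABC-2264 · assembly · rank 1 · closed · moot by None · by planner
sources: BombieriGubler2006, Vojta1987
[assembly] Lemma B (provable now, elementary). Given the p ≥ 4 of the Target and an abc triple,
extract p-th powers canonically: a = A x^p with x = ∏ q^⌊v_q(a)/p⌋, likewise b = B y^p, c = C z^p;
then (A x^p, B y^p, C z^p) is literally the same abc triple, C ≤ rad(c)^(p−1) (every exponent of C
is < p) and rad(ABC) ≤ rad(abc) =: r. Fix δ = 1/2 (any δ ∈ (0, p−3) works) and H₀ = H₀(p, δ). Either
rad(ABC) > H^(p−3−δ), whence H < r^(1/(p−3−δ)) and c = C z^p ≤ r^(p−1) H^p ≤ r^(p−1+p/(p−3−δ)); or H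
≤ H₀ and c ≤ r^(p−1) H₀^p. Since r ≥ 2 for every abc triple, log c ≤ κ log r with κ = p−1+p/(p−3−δ)
+ p·max(0, log H₀)/log 2, and directly c ≤ K·r^A with A = p−1+p/(p−3−δ), K = max(1,H₀)^p: the shared
milestone PolynomialABC (stmt-ABC-1724; = Literature.Barriers.ABC.BakerShapeBound 0 1 up to logs,
the shape the Baker-method barrier records as out of reach of logarithmic forms). HONEST CEILING:
the loss rad(c)^(p−1) is intrinsic, so this route ends at polynomial abc (13/2 + η via p = 5,
QuinticExponentThirteenHalves), not at Summit ABC; ABC ⟹ Target (AbcImpliesTwistHeightBounds)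
records that the Target is nevertheless necessary. -/
@[route_item "route-ABC-FermatTwistHeights"]
def Assembly : Prop :=
  TwistHeightBound → PolynomialABC

end Summit.ABC.ABC.Theses.FermatTwistHeights
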